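import Summits.RiemannHypothesis.RiemannHypothesis.Theorems.PfPersistenceAutocorrSplitLaw
import Summits.RiemannHypothesis.RiemannHypothesis.Theorems.PfPersistenceFloorNodelessOdd
import HarnessLib

/-!
# Persistence — the autocorrelation splitting law: negativity packaging and the `eo` handle (general windows)

**mechanism/rigidity campaign; no RH claims.** `proof.lean` — every statement is RH-free, weight-free and says nothing
about `ζ`'s own membership in any reader. Companion of `PfPersistenceAutocorrSplitLaw` (the LEVEL-DROP law at every
window): here the same test vector `v` that certifies a level drop is used to certify NEGATIVITY (`¬ WindowPositive`,
`DetectablyNegative`) of a down-cone move / a dial at a GENERAL window `(a, N)` reaching the slot, in the four-fold shape of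
`downDial_negative_and_rejected_gen` (which is the mirror-window case `a = log p`); the UP side (`K ≥ 1`, positively
correlated test vector — the Perron side where the twins of record live) gets its negativity threshold too; and the even
rejections are projected to the `eo` cell's two-parity handle `floorNodelessEOAt`.

* `form_neg_witness` — a vector with a negative form value at `win` refutes `WindowPositive` there and witnesses
  `DetectablyNegative`.
* `downCone_negative_of_testVector_autocorr` — `vᵀQ⁺(w)v + 2 Σ_q (w q − w′ q)·A_v(log q) < 0 ⇒ w′` negative at `win`.
* `dial_negative_of_testVector_autocorr` (either sign of `1 − K`), `dial_negative_of_threshold_autocorr` (down: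
  `ℓ < 2(1−K)·w(p)·σ`), `upDial_negative_of_threshold_autocorr` (up: `ℓ < 2(K−1)·w(p)·τ` for a POSITIVELY correlated `v`,
  `τ‖v‖² ≤ A_v(log p)`).
* `not_mem_floorNodelessEOAt_of_downCone_levelDrop`, `dial_not_mem_floorNodelessEOAt_of_threshold` — `eo` projections.
* `dial_negative_and_rejected_autocorr`, `zeta_dial_negative_and_rejected_autocorr` — the four-fold conclusion
  (detectably negative, not window-positive, `∉ floorNodelessAt φ`, `∉ floorNodelessEOAt φ`) at a general window.
-/

set_option linter.dupNamespace false

noncomputable section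

namespace Summit.RiemannHypothesis.RiemannHypothesis.Theorems.PfPersistence

open Matrix BigOperators Finset Real

/-! ## §1 Negativity along a test vector at a general window -/

/-- PROVED: a vector with a negative even-block value at `win` refutes window-positivity there and witnesses detectable
negativity of the datum. [folklore] -/
theorem form_neg_witness {win : Window} {w : Weights} {v : Fin (win.N + 1) → ℝ}
    (hv : v ⬝ᵥ (evenBlock w win *ᵥ v) < 0) :
    ¬ WindowPositive (datumOf w win) ∧ DetectablyNegative (datumOf w) :=
  ⟨fun hW => absurd (hW v) (not_le.2 hv), win, v, hv⟩

/-- **PROVED — DOWN-CONE NEGATIVITY ALONG A TEST VECTOR (general window):** if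
`vᵀQ⁺(w)v + 2 Σ_{q ∈ primeRange 2a} (w q − w′ q)·A_v(log q) < 0` then `w′` is not window-positive at `win` and detectably
negative (witness `v`; no sign condition on `w − w′`). [folklore] -/
theorem downCone_negative_of_testVector_autocorr {win : Window} (w w' : Weights) {v : Fin (win.N + 1) → ℝ}
    (hneg : v ⬝ᵥ (evenBlock w win *ᵥ v)
      + 2 * ∑ q ∈ primeRange (2 * win.a), (w q - w' q) * autocorr (2 * win.a) v (Real.log q) < 0) :
    ¬ WindowPositive (datumOf w' win) ∧ DetectablyNegative (datumOf w') := by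
  have h : v ⬝ᵥ (evenBlock w' win *ᵥ v) < 0 := by rw [form_eq_form_add_sum_autocorr w w' v]; exact hneg
  exact form_neg_witness h

/-- **PROVED — DIAL NEGATIVITY ALONG A TEST VECTOR (general window, either sign of `1 − K`):**
`vᵀQ⁺(w)v + 2(1 − K)·w(p)·A_v(log p) < 0 ⇒` the dial is not window-positive at `win` and detectably negative. [folklore] -/
theorem dial_negative_of_testVector_autocorr {win : Window} {p : ℕ} (hp : p ∈ primeRange (2 * win.a)) (K : ℝ)
    (w : Weights) {v : Fin (win.N + 1) → ℝ}
    (hneg : v ⬝ᵥ (evenBlock w win *ᵥ v) + 2 * (1 - K) * w p * autocorr (2 * win.a) v (Real.log p) < 0) :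
    ¬ WindowPositive (datumOf (dial p K w) win) ∧ DetectablyNegative (datumOf (dial p K w)) := by
  have h : v ⬝ᵥ (evenBlock (dial p K w) win *ᵥ v) < 0 := by
    rw [form_evenBlock_dial hp K w v, primePattern_form_eq_autocorr win.ha]; linarith
  exact form_neg_witness h

/-- **PROVED — DOWN-SIDE NEGATIVITY THRESHOLD:** `v ≠ 0` with `vᵀQ⁺(w)v ≤ ℓ‖v‖²`, anti-correlated at lag `log p`
(`A_v(log p) ≤ −σ‖v‖²`), `K ≤ 1`, `0 ≤ w p` and `ℓ < 2(1 − K)·w(p)·σ` ⇒ the dial is not window-positive at `win` and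
detectably negative. [folklore] -/
theorem dial_negative_of_threshold_autocorr {win : Window} {p : ℕ} (hp : p ∈ primeRange (2 * win.a)) {K : ℝ}
    (hK : K ≤ 1) {w : Weights} (hw : 0 ≤ w p) {v : Fin (win.N + 1) → ℝ} (hv : v ≠ 0) {ℓ σ : ℝ}
    (hℓ : v ⬝ᵥ (evenBlock w win *ᵥ v) ≤ ℓ * (v ⬝ᵥ v))
    (hσ : autocorr (2 * win.a) v (Real.log p) ≤ -σ * (v ⬝ᵥ v)) (ht : ℓ < 2 * (1 - K) * w p * σ) :
    ¬ WindowPositive (datumOf (dial p K w) win) ∧ DetectablyNegative (datumOf (dial p K w)) := by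
  have hvv : 0 < v ⬝ᵥ v :=
    lt_of_le_of_ne (dotProduct_self_nonneg_real v) fun h => hv (dotProduct_self_eq_zero.1 h.symm)
  refine dial_negative_of_testVector_autocorr hp K w (v := v) ?_
  have hc : 0 ≤ 2 * (1 - K) * w p := mul_nonneg (mul_nonneg zero_le_two (sub_nonneg.2 hK)) hw
  have h2 : 2 * (1 - K) * w p * autocorr (2 * win.a) v (Real.log p) ≤ 2 * (1 - K) * w p * (-σ * (v ⬝ᵥ v)) :=
    mul_le_mul_of_nonneg_left hσ hc
  have h3 : ℓ * (v ⬝ᵥ v) < 2 * (1 - K) * w p * σ * (v ⬝ᵥ v) := mul_lt_mul_of_pos_right ht hvv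
  linarith

/-- **PROVED — UP-SIDE NEGATIVITY THRESHOLD (the Perron side):** `v ≠ 0` with `vᵀQ⁺(w)v ≤ ℓ‖v‖²`, POSITIVELY correlated at
lag `log p` (`τ‖v‖² ≤ A_v(log p)`, e.g. a one-signed vector), `1 ≤ K`, `0 ≤ w p` and `ℓ < 2(K − 1)·w(p)·τ` ⇒ the up dial is not
window-positive at `win` and detectably negative. [folklore] -/
theorem upDial_negative_of_threshold_autocorr {win : Window} {p : ℕ} (hp : p ∈ primeRange (2 * win.a)) {K : ℝ}
    (hK : 1 ≤ K) {w : Weights} (hw : 0 ≤ w p) {v : Fin (win.N + 1) → ℝ} (hv : v ≠ 0) {ℓ τ : ℝ}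
    (hℓ : v ⬝ᵥ (evenBlock w win *ᵥ v) ≤ ℓ * (v ⬝ᵥ v))
    (hτ : τ * (v ⬝ᵥ v) ≤ autocorr (2 * win.a) v (Real.log p)) (ht : ℓ < 2 * (K - 1) * w p * τ) :
    ¬ WindowPositive (datumOf (dial p K w) win) ∧ DetectablyNegative (datumOf (dial p K w)) := by
  have hvv : 0 < v ⬝ᵥ v :=
    lt_of_le_of_ne (dotProduct_self_nonneg_real v) fun h => hv (dotProduct_self_eq_zero.1 h.symm)
  refine dial_negative_of_testVector_autocorr hp K w (v := v) ?_
  have hc : 0 ≤ 2 * (K - 1) * w p := mul_nonneg (mul_nonneg zero_le_two (sub_nonneg.2 hK)) hw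
  have h2 : 2 * (K - 1) * w p * (τ * (v ⬝ᵥ v)) ≤ 2 * (K - 1) * w p * autocorr (2 * win.a) v (Real.log p) :=
    mul_le_mul_of_nonneg_left hτ hc
  have h3 : ℓ * (v ⬝ᵥ v) < 2 * (K - 1) * w p * τ * (v ⬝ᵥ v) := mul_lt_mul_of_pos_right ht hvv
  linarith

/-! ## §2 The `eo` handle at a general window -/

/-- PROVED (`eo` projection of the down-cone level-drop law): under the hypotheses of
`not_mem_floorNodelessAt_of_downCone_levelDrop` the move is rejected by the two-parity handle as well. [folklore] -/
theorem not_mem_floorNodelessEOAt_of_downCone_levelDrop {win : Window} {w w' : Weights} {φ : ℝ} (hφ : 0 ≤ φ)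
    (hle : ∀ q ∈ primeRange (2 * win.a), w' q ≤ w q)
    (hdrop : bottomRayleigh (evenBlock w' win) < bottomRayleigh (evenBlock w win)
      - 4 * φ * (2 * win.N + 1) * ∑ q ∈ primeRange (2 * win.a), (w q - w' q)) :
    datumOf w' ∉ floorNodelessEOAt φ win :=
  fun h => not_mem_floorNodelessAt_of_downCone_levelDrop hφ hle hdrop h.1

/-- PROVED (`eo` projection of the dial threshold form). [folklore] -/
theorem dial_not_mem_floorNodelessEOAt_of_threshold {win : Window} {p : ℕ} (hp : p ∈ primeRange (2 * win.a)) {K : ℝ}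
    (hK : K ≤ 1) {w : Weights} (hw : 0 ≤ w p) {φ : ℝ} (hφ : 0 ≤ φ) {v : Fin (win.N + 1) → ℝ} (hv : v ≠ 0)
    {ℓ σ : ℝ} (hℓ : v ⬝ᵥ (evenBlock w win *ᵥ v) ≤ ℓ * (v ⬝ᵥ v))
    (hσ : autocorr (2 * win.a) v (Real.log p) ≤ -σ * (v ⬝ᵥ v))
    (ht : ℓ - bottomRayleigh (evenBlock w win) < 2 * (1 - K) * w p * (σ - 2 * φ * (2 * win.N + 1))) :
    datumOf (dial p K w) ∉ floorNodelessEOAt φ win :=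
  fun h => dial_not_mem_floorNodelessAt_of_threshold hp hK hw hφ hv hℓ hσ ht h.1

/-! ## §3 Negative and rejected — the four-fold conclusion at a general window -/

/-- **PROVED — NEGATIVE AND REJECTED (autocorrelation form, down sign, general window):** one test vector `v ≠ 0` with
level bound `ℓ`, anti-correlation `σ` at lag `log p`, `K ≤ 1`, `0 ≤ w p`, `ℓ < 2(1−K)·w(p)·σ` (negativity) and
`ℓ − ε₁(Q⁺(w)) < 2(1−K)·w(p)·(σ − 2φ(2N+1))` (splitting) makes the dial detectably negative, not window-positive at `win`,
and rejected there by `floorNodelessAt φ` and `floorNodelessEOAt φ`. [folklore] -/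
theorem dial_negative_and_rejected_autocorr {win : Window} {p : ℕ} (hp : p ∈ primeRange (2 * win.a)) {K : ℝ}
    (hK : K ≤ 1) {w : Weights} (hw : 0 ≤ w p) {φ : ℝ} (hφ : 0 ≤ φ) {v : Fin (win.N + 1) → ℝ} (hv : v ≠ 0)
    {ℓ σ : ℝ} (hℓ : v ⬝ᵥ (evenBlock w win *ᵥ v) ≤ ℓ * (v ⬝ᵥ v))
    (hσ : autocorr (2 * win.a) v (Real.log p) ≤ -σ * (v ⬝ᵥ v)) (hneg : ℓ < 2 * (1 - K) * w p * σ)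
    (hsplit : ℓ - bottomRayleigh (evenBlock w win) < 2 * (1 - K) * w p * (σ - 2 * φ * (2 * win.N + 1))) :
    DetectablyNegative (datumOf (dial p K w)) ∧ ¬ WindowPositive (datumOf (dial p K w) win) ∧
      datumOf (dial p K w) ∉ floorNodelessAt φ win ∧ datumOf (dial p K w) ∉ floorNodelessEOAt φ win := by
  have hn := dial_negative_of_threshold_autocorr hp hK hw hv hℓ hσ hneg
  exact ⟨hn.2, hn.1, dial_not_mem_floorNodelessAt_of_threshold hp hK hw hφ hv hℓ hσ hsplit,
    dial_not_mem_floorNodelessEOAt_of_threshold hp hK hw hφ hv hℓ hσ hsplit⟩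

/-- PROVED (`ζ` handle, down sign, any slot `p ∈ primeRange 2a`, `K ≤ 1`). [folklore] -/
theorem zeta_dial_negative_and_rejected_autocorr {win : Window} {p : ℕ} (hp : p ∈ primeRange (2 * win.a)) {K : ℝ}
    (hK : K ≤ 1) {φ : ℝ} (hφ : 0 ≤ φ) {v : Fin (win.N + 1) → ℝ} (hv : v ≠ 0) {ℓ σ : ℝ}
    (hℓ : v ⬝ᵥ (evenBlock zetaWeights win *ᵥ v) ≤ ℓ * (v ⬝ᵥ v))
    (hσ : autocorr (2 * win.a) v (Real.log p) ≤ -σ * (v ⬝ᵥ v)) (hneg : ℓ < 2 * (1 - K) * zetaWeights p * σ)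
    (hsplit : ℓ - bottomRayleigh (evenBlock zetaWeights win)
      < 2 * (1 - K) * zetaWeights p * (σ - 2 * φ * (2 * win.N + 1))) :
    DetectablyNegative (datumOf (dial p K zetaWeights)) ∧ ¬ WindowPositive (datumOf (dial p K zetaWeights) win) ∧
      datumOf (dial p K zetaWeights) ∉ floorNodelessAt φ win ∧
      datumOf (dial p K zetaWeights) ∉ floorNodelessEOAt φ win :=
  dial_negative_and_rejected_autocorr hp hK (zetaWeights_nonneg p) hφ hv hℓ hσ hneg hsplit

end Summit.RiemannHypothesis.RiemannHypothesis.Theorems.PfPersistence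

end
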